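import Mathlib
import Literature.NumberTheory.Transcendental.KZCalculusProofs
import Literature.NumberTheory.Transcendental.KZCubicalCalculus
import Literature.NumberTheory.Transcendental.KZLogCalculusProofs
import Literature.NumberTheory.Transcendental.KZRegCalculus
import Summits.KontsevichZagierPeriods.KontsevichZagierPeriods.Theorems.HurwitzMicroSectorsNormalFormPrinciplePiBoxUnitBox

/-!
# OffTetraSectorKernel (stmt-KontsevichZagierPeriods-10557), line odd-hyperbolic-ladder: stub stub_cubeDensityTransfer

MOSER FORM ⇒ CUBE ORBIT (same dimension, oracle-generic). Let `W` be any subgroup of the formal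
group `KZ.FormalRep`. If, on the unit cube `[0,1]^{d+1}`, every non-negative `ℚ`-semialgebraic
density of mass `1` is move-equivalent modulo `relations ⊔ W` to the uniform density, then every
compact integrand-`1` solid `K ⊆ ℝ^{d+1}` of volume `1` is move-equivalent modulo `relations ⊔ W`
to the unit cube with integrand `1`.

Proof. `K` is compact, hence bounded; one integer translation and one rational homothety
(rule (2), constant Jacobian; packaged as `PiBox.exists_unitBox_model`) turn `[K]` into `[B]` with
`B.domain` inside the open unit box and `B.integrand` the constant `T^{d+1}`. Extending that
constant by zero gives a non-negative density `G` on the closed cube with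
`[G] − [B] − [Z] ∈ domainAddRel` (rule (1a)), where the zero part `[Z]` is itself a relation;
soundness gives `G.value = B.value = K.value = 1`, so the Moser hypothesis connects `[G]` to the
cube `[Q]`, and the bookkeeping closes in the free abelian group.
-/

noncomputable section

open Set MeasureTheory
open Literature.NumberTheory.Transcendental

namespace Summit.KontsevichZagierPeriods.HyperbolicBloch.OffTetraSectorKernel

/-- **Extension by zero to the cube** (rule (1a)). A representation `B` with domain inside the
closed unit cube `[0,1]^n` extends to a representation `G` on the whole cube with integrand
`1_{B.domain} · B.integrand`, and `[G] − [B] ∈ relations`: domain additivity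
`[0,1]^n = B.domain ∪ ([0,1]^n ∖ B.domain)` (disjoint pieces), the second piece carrying the zero
integrand and hence being a relation (`KZ.of_mem_relations_of_eqOn_zero`).
[Kontsevich–Zagier 2001, §1.2, rule (1)] [folklore] -/
theorem cdt_exists_extendByZero_cube {n : ℕ} (B : KZ.IntegralRep n)
    (hB : B.domain ⊆ KZ.cube n) :
    ∃ G : KZ.IntegralRep n, G.domain = KZ.cube n ∧
      G.integrand = B.domain.indicator B.integrand ∧ KZ.of G - KZ.of B ∈ KZ.relations := by
  have hcube : Literature.ModelTheory.ExponentialFields.IsSemialgebraic ℚ (KZ.cube n) :=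
    KZ.isSemialgebraic_cube
  have hBm : MeasurableSet B.domain := KZ.IntegralRep.measurableSet_domain_holds B
  -- the extension by zero
  let G : KZ.IntegralRep n :=
    { domain := KZ.cube n
      integrand := B.domain.indicator B.integrand
      isSemialgebraic_domain := hcube
      isSemialgebraicFunOn_integrand :=
        IsSemialgebraicFunOn.indicator hcube B.isSemialgebraic_domain
          (B.isSemialgebraicFunOn_integrand.mono inter_subset_right
            (hcube.inter B.isSemialgebraic_domain))
      integrableOn := ((integrable_indicator_iff hBm).mpr B.integrableOn).integrableOn }
  -- the zero part, on the complement of `B.domain` in the cube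
  have hdiff : Literature.ModelTheory.ExponentialFields.IsSemialgebraic ℚ (KZ.cube n \ B.domain) :=
    hcube.diff B.isSemialgebraic_domain
  let Z : KZ.IntegralRep n := G.restrict (KZ.cube n \ B.domain) hdiff sdiff_subset
  have hZ : KZ.of Z ∈ KZ.relations :=
    KZ.of_mem_relations_of_eqOn_zero Z fun x hx => indicator_of_notMem hx.2 _
  -- domain additivity
  have hadd : KZ.of G - KZ.of B - KZ.of Z ∈ KZ.domainAddRel := by
    refine ⟨n, G, B, Z, ?_, ?_, fun x hx => indicator_of_mem hx _, fun _ _ => rfl, rfl⟩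
    · show KZ.cube n = B.domain ∪ (KZ.cube n \ B.domain)
      exact (union_sdiff_cancel hB).symm
    · show volume (B.domain ∩ (KZ.cube n \ B.domain)) = 0
      rw [inter_sdiff_self, measure_empty]
  refine ⟨G, rfl, rfl, ?_⟩
  have key : KZ.of G - KZ.of B = (KZ.of G - KZ.of B - KZ.of Z) + KZ.of Z := by abel
  rw [key]
  exact add_mem (KZ.domainAddRel_subset_relations hadd) hZ

/-- STUB `stub_cubeDensityTransfer` (MOSER FORM ⇒ CUBE ORBIT, same dimension): if every
non-negative density of mass `1` on `[0,1]^{d+1}` reaches the uniform density modulo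
`relations ⊔ W`, then every compact integrand-`1` solid of `ℝ^{d+1}` of volume `1` reaches
`[0,1]^{d+1}` modulo `relations ⊔ W` (one integer translation and one rational homothety into the
cube, rule (2); extension by zero, rule (1a)).
[cite: KontsevichZagier2001, §1.2 rules (1), (2)] -/
theorem stub_cubeDensityTransfer (W : AddSubgroup KZ.FormalRep) (d : ℕ)
    (hdens : ∀ (G Q : KZ.IntegralRep (d + 1)), G.domain = KZ.cube (d + 1) →
      (∀ x ∈ G.domain, 0 ≤ G.integrand x) → Q.domain = KZ.cube (d + 1) →
      (∀ x ∈ Q.domain, Q.integrand x = 1) → G.value = 1 → KZ.of G - KZ.of Q ∈ KZ.relations ⊔ W)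
    (K Q : KZ.IntegralRep (d + 1)) (hKc : IsCompact K.domain) (hK1 : ∀ x ∈ K.domain, K.integrand x = 1)
    (hQ : Q.domain = KZ.cube (d + 1)) (hQ1 : ∀ x ∈ Q.domain, Q.integrand x = 1) (hKv : K.value = 1) :
    KZ.of K - KZ.of Q ∈ KZ.relations ⊔ W := by
  -- translate and scale `K` into the open unit box: constant integrand `T ^ (d + 1)`
  obtain ⟨T, B, -, hBsub, hBi, e₁⟩ :=
    Summit.KontsevichZagierPeriods.HurwitzMicroSectors.NormalFormPrinciple.PiBox.exists_unitBox_model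
      K hKc.isBounded hK1
  have hBcube : B.domain ⊆ KZ.cube (d + 1) := fun y hy i => ⟨(hBsub hy i).1.le, (hBsub hy i).2.le⟩
  -- extend by zero to a density `G` on the closed cube
  obtain ⟨G, hGd, hGi, e₂⟩ := cdt_exists_extendByZero_cube B hBcube
  -- `G` is non-negative on the cube
  have hG0 : ∀ x ∈ G.domain, 0 ≤ G.integrand x := fun x _ => by
    rw [hGi]
    exact Set.indicator_nonneg (fun y _ => by rw [hBi]; positivity) x
  -- `G` has mass `1` (soundness of the moves)
  have hGv : G.value = 1 := by
    have h₁ : KZ.eval (KZ.of K - KZ.of B) = 0 := KZ.relations_le_ker_eval_holds e₁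
    have h₂ : KZ.eval (KZ.of G - KZ.of B) = 0 := KZ.relations_le_ker_eval_holds e₂
    simp only [map_sub, KZ.eval_of, hKv] at h₁ h₂
    linarith
  -- the Moser hypothesis
  have h₃ : KZ.of G - KZ.of Q ∈ KZ.relations ⊔ W := hdens G Q hGd hG0 hQ hQ1 hGv
  -- bookkeeping in the free abelian group
  have key : KZ.of K - KZ.of Q = (KZ.of K - KZ.of B) - (KZ.of G - KZ.of B) + (KZ.of G - KZ.of Q) := by
    abel
  rw [key]
  exact add_mem (sub_mem (AddSubgroup.mem_sup_left e₁) (AddSubgroup.mem_sup_left e₂)) h₃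

end Summit.KontsevichZagierPeriods.HyperbolicBloch.OffTetraSectorKernel

end
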